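import Mathlib

/-!
# Stub `stub_psdTraceTwoPoint` of line `crossing-split-integrability`
(crux `Summit.QuantumFields.QCD.Theses.PauliWegnerSea.PhaseQuenchedFlavourDecay`, item stmt-QuantumFields-9151)

**The transfer-matrix two-point bound (Mathlib only).**  For a positive semidefinite complex
matrix `T`, matrices `A`, `B` whose quadratic forms `v ↦ ‖A v‖²`, `v ↦ ‖Aᴴ v‖²` (resp. `B`, `Bᴴ`)
are bounded by `α² ‖v‖²` (resp. `γ² ‖v‖²`), and all `a b : ℕ`,

  `|Tr (T^a A T^b B)| ≤ α γ · Tr (T^(a+b))`.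

Proof.  Diagonalise `T = U D Uᴴ` (`Matrix.IsHermitian.spectral_theorem`, `D = diag λ`, `λ ≥ 0`,
`U` unitary), so `T^k = U D^k Uᴴ` and, with `M = Uᴴ A U`, `N = Uᴴ B U`,
`Tr (T^a A T^b B) = Tr (D^a M D^b N) = Σ_{ij} λ_i^a M_{ij} λ_j^b N_{ji}` while
`Tr (T^(a+b)) = Σ_i λ_i^(a+b)`.  The operator-norm hypotheses are invariant under the unitary
conjugation and, evaluated at basis vectors, bound every row and every column of `M` (resp. `N`)
in `ℓ²` by `α` (resp. `γ`).  Weighted AM–GM `λ_i^a λ_j^b ≤ p λ_i^(a+b) + q λ_j^(a+b)`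
(`p = a/(a+b)`, `q = b/(a+b)`; `p = 1, q = 0` if `a = b = 0`) splits the double sum into an
`i`-weighted and a `j`-weighted part, each bounded by Cauchy–Schwarz (row of `M` against column
of `N`, resp. column of `M` against row of `N`) by `α γ Σ_i λ_i^(a+b)`.
-/

noncomputable section

namespace Summit.QuantumFields.QCD.Cruxes.PhaseQuenchedFlavourDecay.CrossingSplitIntegrability

open Matrix
open scoped BigOperators ComplexOrder

/-! ### Real inequalities -/

/-- **Weighted AM–GM for natural powers**: for every `a b : ℕ` there are weights `p, q ≥ 0`,
`p + q = 1`, with `x^a y^b ≤ p x^(a+b) + q y^(a+b)` for all `x, y ≥ 0`. -/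
theorem psdTraceTwoPoint_young (a b : ℕ) :
    ∃ p q : ℝ, 0 ≤ p ∧ 0 ≤ q ∧ p + q = 1 ∧
      ∀ x y : ℝ, 0 ≤ x → 0 ≤ y → x ^ a * y ^ b ≤ p * x ^ (a + b) + q * y ^ (a + b) := by
  rcases Nat.eq_zero_or_pos (a + b) with hab | hab
  · obtain ⟨rfl, rfl⟩ : a = 0 ∧ b = 0 := by omega
    exact ⟨1, 0, zero_le_one, le_rfl, by ring, fun x y _ _ => by simp⟩
  · have hs : (0 : ℝ) < a + b := by exact_mod_cast hab
    refine ⟨a / (a + b), b / (a + b), by positivity, by positivity,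
      by rw [← add_div, div_self hs.ne'], fun x y hx hy => ?_⟩
    have h := Real.geom_mean_le_arith_mean2_weighted (w₁ := a / (a + b)) (w₂ := b / (a + b))
      (p₁ := x ^ (a + b)) (p₂ := y ^ (a + b)) (by positivity) (by positivity) (by positivity)
      (by positivity) (by rw [← add_div, div_self hs.ne'])
    convert h using 2
    · rw [← Real.rpow_natCast x (a + b), ← Real.rpow_mul hx, ← Real.rpow_natCast x a]
      congr 1
      push_cast
      field_simp
    · rw [← Real.rpow_natCast y (a + b), ← Real.rpow_mul hy, ← Real.rpow_natCast y b]
      congr 1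
      push_cast
      field_simp

/-- **Cauchy–Schwarz with square bounds**: `Σ f g ≤ s t` if `Σ f² ≤ s²`, `Σ g² ≤ t²`, `s, t ≥ 0`. -/
theorem psdTraceTwoPoint_sum_mul_le {ι : Type*} (S : Finset ι) (f g : ι → ℝ) {s t : ℝ}
    (hs : 0 ≤ s) (ht : 0 ≤ t) (hf : ∑ i ∈ S, f i ^ 2 ≤ s ^ 2) (hg : ∑ i ∈ S, g i ^ 2 ≤ t ^ 2) :
    ∑ i ∈ S, f i * g i ≤ s * t := by
  calc ∑ i ∈ S, f i * g i ≤ √(∑ i ∈ S, f i ^ 2) * √(∑ i ∈ S, g i ^ 2) :=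
        Real.sum_mul_le_sqrt_mul_sqrt S f g
    _ ≤ √(s ^ 2) * √(t ^ 2) := by gcongr
    _ = s * t := by rw [Real.sqrt_sq hs, Real.sqrt_sq ht]

/-- **The weighted double-sum bound**: for `d ≥ 0`, `w ≥ 0` with all row sums and all column sums
of `w` at most `c`, `Σ_{ij} d_i^a d_j^b w_{ij} ≤ c Σ_i d_i^(a+b)`. -/
theorem psdTraceTwoPoint_doubleSum_le {n : ℕ} (d : Fin n → ℝ) (hd : ∀ i, 0 ≤ d i)
    (w : Fin n → Fin n → ℝ) (hw : ∀ i j, 0 ≤ w i j) {c : ℝ}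
    (hrow : ∀ i, ∑ j, w i j ≤ c) (hcol : ∀ j, ∑ i, w i j ≤ c) (a b : ℕ) :
    ∑ i, ∑ j, d i ^ a * d j ^ b * w i j ≤ c * ∑ i, d i ^ (a + b) := by
  obtain ⟨p, q, hp, hq, hpq, hyoung⟩ := psdTraceTwoPoint_young a b
  have hdk : ∀ i, 0 ≤ d i ^ (a + b) := fun i => pow_nonneg (hd i) _
  have hsplit : ∀ i j, (p * d i ^ (a + b) + q * d j ^ (a + b)) * w i j
      = p * (d i ^ (a + b) * w i j) + q * (d j ^ (a + b) * w i j) := fun i j => by ring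
  calc ∑ i, ∑ j, d i ^ a * d j ^ b * w i j
      ≤ ∑ i, ∑ j, (p * d i ^ (a + b) + q * d j ^ (a + b)) * w i j :=
        Finset.sum_le_sum fun i _ => Finset.sum_le_sum fun j _ =>
          mul_le_mul_of_nonneg_right (hyoung _ _ (hd i) (hd j)) (hw i j)
    _ = p * ∑ i, d i ^ (a + b) * ∑ j, w i j + q * ∑ j, d j ^ (a + b) * ∑ i, w i j := by
        simp_rw [hsplit, Finset.sum_add_distrib, ← Finset.mul_sum]
        congr 2
        rw [Finset.sum_comm]
        simp_rw [Finset.mul_sum]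
    _ ≤ p * ∑ i, d i ^ (a + b) * c + q * ∑ j, d j ^ (a + b) * c :=
        add_le_add
          (mul_le_mul_of_nonneg_left
            (Finset.sum_le_sum fun i _ => mul_le_mul_of_nonneg_left (hrow i) (hdk i)) hp)
          (mul_le_mul_of_nonneg_left
            (Finset.sum_le_sum fun j _ => mul_le_mul_of_nonneg_left (hcol j) (hdk j)) hq)
    _ = c * ∑ i, d i ^ (a + b) := by
        rw [← Finset.sum_mul]
        linear_combination (c * ∑ i, d i ^ (a + b)) * hpq

/-! ### Quadratic forms, unitary conjugation, rows and columns -/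

/-- `Re (star w ⬝ᵥ w) = Σ_i ‖w_i‖²`. -/
theorem psdTraceTwoPoint_re_star_dotProduct_self {n : ℕ} (w : Fin n → ℂ) :
    (star w ⬝ᵥ w).re = ∑ i, ‖w i‖ ^ 2 := by
  simp only [dotProduct, Pi.star_apply, Complex.star_def, Complex.conj_mul', Complex.re_sum,
    ← Complex.ofReal_pow, Complex.ofReal_re]

/-- A matrix `X` with `Xᴴ X = 1` preserves the quadratic form `star w ⬝ᵥ w`. -/
theorem psdTraceTwoPoint_star_mulVec_dotProduct {n : ℕ} (X : Matrix (Fin n) (Fin n) ℂ)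
    (hX : Xᴴ * X = 1) (w : Fin n → ℂ) : star (X *ᵥ w) ⬝ᵥ (X *ᵥ w) = star w ⬝ᵥ w := by
  rw [star_mulVec, ← dotProduct_mulVec, mulVec_mulVec, hX, one_mulVec]

/-- Quadratic-form (operator-norm) bounds are invariant under unitary conjugation
`M ↦ Uᴴ M U`. -/
theorem psdTraceTwoPoint_bound_conj {n : ℕ} (U M : Matrix (Fin n) (Fin n) ℂ)
    (hU : Uᴴ * U = 1) (hU' : U * Uᴴ = 1) {c : ℝ}
    (hM : ∀ v : Fin n → ℂ, (star (M *ᵥ v) ⬝ᵥ (M *ᵥ v)).re ≤ c ^ 2 * (star v ⬝ᵥ v).re)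
    (v : Fin n → ℂ) :
    (star ((Uᴴ * M * U) *ᵥ v) ⬝ᵥ ((Uᴴ * M * U) *ᵥ v)).re ≤ c ^ 2 * (star v ⬝ᵥ v).re := by
  have h1 : (Uᴴ * M * U) *ᵥ v = Uᴴ *ᵥ (M *ᵥ (U *ᵥ v)) := by
    rw [mulVec_mulVec, mulVec_mulVec]
  have hU'' : Uᴴᴴ * Uᴴ = 1 := by rwa [conjTranspose_conjTranspose]
  rw [h1, psdTraceTwoPoint_star_mulVec_dotProduct Uᴴ hU'']
  calc (star (M *ᵥ U *ᵥ v) ⬝ᵥ M *ᵥ U *ᵥ v).re ≤ c ^ 2 * (star (U *ᵥ v) ⬝ᵥ U *ᵥ v).re := hM _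
    _ = c ^ 2 * (star v ⬝ᵥ v).re := by rw [psdTraceTwoPoint_star_mulVec_dotProduct U hU]

/-- The conjugate transpose of a unitary conjugate: `(Uᴴ M U)ᴴ = Uᴴ Mᴴ U`. -/
theorem psdTraceTwoPoint_conjTranspose_conj {n : ℕ} (U M : Matrix (Fin n) (Fin n) ℂ) :
    (Uᴴ * M * U)ᴴ = Uᴴ * Mᴴ * U := by
  rw [conjTranspose_mul, conjTranspose_mul, conjTranspose_conjTranspose, Matrix.mul_assoc]

/-- A quadratic-form bound for `M` bounds every **column** of `M` in `ℓ²`. -/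
theorem psdTraceTwoPoint_col_sq_le {n : ℕ} (M : Matrix (Fin n) (Fin n) ℂ) {c : ℝ}
    (hM : ∀ v : Fin n → ℂ, (star (M *ᵥ v) ⬝ᵥ (M *ᵥ v)).re ≤ c ^ 2 * (star v ⬝ᵥ v).re)
    (j : Fin n) : ∑ i, ‖M i j‖ ^ 2 ≤ c ^ 2 := by
  have h := hM (Pi.single j 1)
  rw [psdTraceTwoPoint_re_star_dotProduct_self (M *ᵥ Pi.single j 1), mulVec_single_one,
    dotProduct_single_one] at h
  simpa using h

/-- A quadratic-form bound for `Mᴴ` bounds every **row** of `M` in `ℓ²`. -/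
theorem psdTraceTwoPoint_row_sq_le {n : ℕ} (M : Matrix (Fin n) (Fin n) ℂ) {c : ℝ}
    (hM : ∀ v : Fin n → ℂ, (star (Mᴴ *ᵥ v) ⬝ᵥ (Mᴴ *ᵥ v)).re ≤ c ^ 2 * (star v ⬝ᵥ v).re)
    (i : Fin n) : ∑ j, ‖M i j‖ ^ 2 ≤ c ^ 2 := by
  have h := psdTraceTwoPoint_col_sq_le Mᴴ hM i
  simpa [conjTranspose_apply] using h

/-! ### Traces -/

/-- `Tr (X N) = Σ_i Σ_j X_{ij} N_{ji}`. -/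
theorem psdTraceTwoPoint_trace_mul_eq {n : ℕ} (X N : Matrix (Fin n) (Fin n) ℂ) :
    (X * N).trace = ∑ i, ∑ j, X i j * N j i := by
  simp [Matrix.trace, Matrix.mul_apply]

/-- `Tr (U X Uᴴ) = Tr X` when `Uᴴ U = 1`. -/
theorem psdTraceTwoPoint_trace_conj {n : ℕ} (U X : Matrix (Fin n) (Fin n) ℂ) (hU : Uᴴ * U = 1) :
    (U * X * Uᴴ).trace = X.trace := by
  rw [trace_mul_cycle, hU, Matrix.one_mul]

/-- Powers of a unitary conjugate: `(U D Uᴴ)^k = U D^k Uᴴ`. -/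
theorem psdTraceTwoPoint_conj_pow {n : ℕ} (U D : Matrix (Fin n) (Fin n) ℂ) (hU : Uᴴ * U = 1)
    (hU' : U * Uᴴ = 1) (k : ℕ) : (U * D * Uᴴ) ^ k = U * D ^ k * Uᴴ := by
  induction k with
  | zero => simp [hU']
  | succ k ih =>
    rw [pow_succ, ih, pow_succ]
    simp only [Matrix.mul_assoc]
    rw [← Matrix.mul_assoc Uᴴ U, hU, Matrix.one_mul]

/-! ### The diagonal case -/

/-- **The bound in the eigenbasis**: for `D = diag d`, `d ≥ 0`, and `M`, `N` with all rows and
columns bounded in `ℓ²` by `α` resp. `γ`, `|Tr (D^a M D^b N)| ≤ α γ Σ_i d_i^(a+b)`. -/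
theorem psdTraceTwoPoint_diagonal {n : ℕ} (d : Fin n → ℝ) (hd : ∀ i, 0 ≤ d i)
    (M N : Matrix (Fin n) (Fin n) ℂ) {α γ : ℝ} (hα : 0 ≤ α) (hγ : 0 ≤ γ)
    (hMrow : ∀ i, ∑ j, ‖M i j‖ ^ 2 ≤ α ^ 2) (hMcol : ∀ j, ∑ i, ‖M i j‖ ^ 2 ≤ α ^ 2)
    (hNrow : ∀ i, ∑ j, ‖N i j‖ ^ 2 ≤ γ ^ 2) (hNcol : ∀ j, ∑ i, ‖N i j‖ ^ 2 ≤ γ ^ 2) (a b : ℕ) :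
    ‖(diagonal (fun i => (d i : ℂ)) ^ a * M * diagonal (fun i => (d i : ℂ)) ^ b * N).trace‖
      ≤ α * γ * ∑ i, d i ^ (a + b) := by
  rw [diagonal_pow, diagonal_pow, psdTraceTwoPoint_trace_mul_eq]
  simp only [mul_diagonal, diagonal_mul, Pi.pow_apply]
  calc ‖∑ i, ∑ j, (d i : ℂ) ^ a * M i j * (d j : ℂ) ^ b * N j i‖
      ≤ ∑ i, ‖∑ j, (d i : ℂ) ^ a * M i j * (d j : ℂ) ^ b * N j i‖ := norm_sum_le _ _
    _ ≤ ∑ i, ∑ j, ‖(d i : ℂ) ^ a * M i j * (d j : ℂ) ^ b * N j i‖ :=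
        Finset.sum_le_sum fun i _ => norm_sum_le _ _
    _ = ∑ i, ∑ j, d i ^ a * d j ^ b * (‖M i j‖ * ‖N j i‖) := by
        refine Finset.sum_congr rfl fun i _ => Finset.sum_congr rfl fun j _ => ?_
        simp only [norm_mul, norm_pow, Complex.norm_real, Real.norm_of_nonneg (hd i),
          Real.norm_of_nonneg (hd j)]
        ring
    _ ≤ α * γ * ∑ i, d i ^ (a + b) := by
        refine psdTraceTwoPoint_doubleSum_le d hd (fun i j => ‖M i j‖ * ‖N j i‖)
          (fun i j => mul_nonneg (norm_nonneg _) (norm_nonneg _)) (fun i => ?_) (fun j => ?_) a b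
        · exact psdTraceTwoPoint_sum_mul_le _ (fun j => ‖M i j‖) (fun j => ‖N j i‖) hα hγ
            (hMrow i) (hNcol i)
        · exact psdTraceTwoPoint_sum_mul_le _ (fun i => ‖M i j‖) (fun i => ‖N j i‖) hα hγ
            (hMcol j) (hNrow j)

/-! ### Assembly -/

/-- **The bound from a unitary diagonalisation** `T = U (diag d) Uᴴ`, `d ≥ 0`. -/
theorem psdTraceTwoPoint_of_decomposition {n : ℕ} (T A B U : Matrix (Fin n) (Fin n) ℂ)
    (d : Fin n → ℝ) (hd : ∀ i, 0 ≤ d i) (hU : Uᴴ * U = 1) (hU' : U * Uᴴ = 1)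
    (hT : T = U * diagonal (fun i => (d i : ℂ)) * Uᴴ) {α γ : ℝ} (hα : 0 ≤ α) (hγ : 0 ≤ γ)
    (hA : ∀ v : Fin n → ℂ, (star (A *ᵥ v) ⬝ᵥ (A *ᵥ v)).re ≤ α ^ 2 * (star v ⬝ᵥ v).re)
    (hAc : ∀ v : Fin n → ℂ, (star (Aᴴ *ᵥ v) ⬝ᵥ (Aᴴ *ᵥ v)).re ≤ α ^ 2 * (star v ⬝ᵥ v).re)
    (hB : ∀ v : Fin n → ℂ, (star (B *ᵥ v) ⬝ᵥ (B *ᵥ v)).re ≤ γ ^ 2 * (star v ⬝ᵥ v).re)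
    (hBc : ∀ v : Fin n → ℂ, (star (Bᴴ *ᵥ v) ⬝ᵥ (Bᴴ *ᵥ v)).re ≤ γ ^ 2 * (star v ⬝ᵥ v).re)
    (a b : ℕ) :
    ‖(T ^ a * A * T ^ b * B).trace‖ ≤ α * γ * ((T ^ (a + b)).trace).re := by
  subst hT
  have hpow := psdTraceTwoPoint_conj_pow U (diagonal (fun i => (d i : ℂ))) hU hU'
  rw [hpow a, hpow b, hpow (a + b)]
  -- the conjugated insertions `M = Uᴴ A U`, `N = Uᴴ B U` and their row / column bounds
  have hM := psdTraceTwoPoint_bound_conj U A hU hU' hA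
  have hN := psdTraceTwoPoint_bound_conj U B hU hU' hB
  have hMc : ∀ v : Fin n → ℂ, (star ((Uᴴ * A * U)ᴴ *ᵥ v) ⬝ᵥ ((Uᴴ * A * U)ᴴ *ᵥ v)).re
      ≤ α ^ 2 * (star v ⬝ᵥ v).re := by
    rw [psdTraceTwoPoint_conjTranspose_conj]
    exact psdTraceTwoPoint_bound_conj U Aᴴ hU hU' hAc
  have hNc : ∀ v : Fin n → ℂ, (star ((Uᴴ * B * U)ᴴ *ᵥ v) ⬝ᵥ ((Uᴴ * B * U)ᴴ *ᵥ v)).re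
      ≤ γ ^ 2 * (star v ⬝ᵥ v).re := by
    rw [psdTraceTwoPoint_conjTranspose_conj]
    exact psdTraceTwoPoint_bound_conj U Bᴴ hU hU' hBc
  -- move everything into the eigenbasis
  have hkey : U * diagonal (fun i => (d i : ℂ)) ^ a * Uᴴ * A *
      (U * diagonal (fun i => (d i : ℂ)) ^ b * Uᴴ) * B =
      U * (diagonal (fun i => (d i : ℂ)) ^ a * (Uᴴ * A * U) * diagonal (fun i => (d i : ℂ)) ^ b *
        (Uᴴ * B * U)) * Uᴴ := by
    simp only [Matrix.mul_assoc, hU', Matrix.mul_one]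
  have htr : ((U * diagonal (fun i => (d i : ℂ)) ^ (a + b) * Uᴴ).trace).re = ∑ i, d i ^ (a + b) := by
    rw [psdTraceTwoPoint_trace_conj U _ hU, diagonal_pow, trace_diagonal]
    simp only [Pi.pow_apply, Complex.re_sum, ← Complex.ofReal_pow, Complex.ofReal_re]
  rw [hkey, psdTraceTwoPoint_trace_conj U _ hU, htr]
  exact psdTraceTwoPoint_diagonal d hd (Uᴴ * A * U) (Uᴴ * B * U) hα hγ
    (psdTraceTwoPoint_row_sq_le _ hMc) (psdTraceTwoPoint_col_sq_le _ hM)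
    (psdTraceTwoPoint_row_sq_le _ hNc) (psdTraceTwoPoint_col_sq_le _ hN) a b

/-! ### The registered stub -/

/-- **Registered stub `stub_psdTraceTwoPoint`** (additive, Mathlib-only; the kernel of the
transfer-matrix two-point bound (T2)).  For a positive semidefinite `T` and matrices `A`, `B` with
quadratic-form (operator-norm) bounds `α`, `γ` (stated for the matrices and their conjugate
transposes): `|Tr (T^a A T^b B)| ≤ α γ · Re Tr (T^(a+b))` for all `a b : ℕ`.  With `T = 𝕋` the
one-step transfer matrix and `A`, `B` (conjugated) insertions it says that all two-point functions
of bounded insertions are bounded by the product of the norms, at every separation. -/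
theorem stub_psdTraceTwoPoint :
    ∀ (n : ℕ) (T A B : Matrix (Fin n) (Fin n) ℂ) (α γ : ℝ), T.PosSemidef → 0 ≤ α → 0 ≤ γ → (∀ v : Fin n → ℂ, (dotProduct (star (A.mulVec v)) (A.mulVec v)).re ≤ α ^ 2 * (dotProduct (star v) v).re) → (∀ v : Fin n → ℂ, (dotProduct (star (A.conjTranspose.mulVec v)) (A.conjTranspose.mulVec v)).re ≤ α ^ 2 * (dotProduct (star v) v).re) → (∀ v : Fin n → ℂ, (dotProduct (star (B.mulVec v)) (B.mulVec v)).re ≤ γ ^ 2 * (dotProduct (star v) v).re) → (∀ v : Fin n → ℂ, (dotProduct (star (B.conjTranspose.mulVec v)) (B.conjTranspose.mulVec v)).re ≤ γ ^ 2 * (dotProduct (star v) v).re) → ∀ a b : ℕ, ‖(T ^ a * A * T ^ b * B).trace‖ ≤ α * γ * ((T ^ (a + b)).trace).re := by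
  intro n T A B α γ hT hα hγ hA hAc hB hBc a b
  have hU : (hT.1.eigenvectorUnitary : Matrix (Fin n) (Fin n) ℂ)ᴴ *
      (hT.1.eigenvectorUnitary : Matrix (Fin n) (Fin n) ℂ) = 1 :=
    Unitary.coe_star_mul_self hT.1.eigenvectorUnitary
  have hU' : (hT.1.eigenvectorUnitary : Matrix (Fin n) (Fin n) ℂ) *
      (hT.1.eigenvectorUnitary : Matrix (Fin n) (Fin n) ℂ)ᴴ = 1 :=
    Unitary.coe_mul_star_self hT.1.eigenvectorUnitary
  have hspec : T = (hT.1.eigenvectorUnitary : Matrix (Fin n) (Fin n) ℂ) *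
      diagonal (fun i => ((hT.1.eigenvalues i : ℝ) : ℂ)) *
        (hT.1.eigenvectorUnitary : Matrix (Fin n) (Fin n) ℂ)ᴴ := by
    conv_lhs => rw [hT.1.spectral_theorem, Unitary.conjStarAlgAut_apply]
    rfl
  exact psdTraceTwoPoint_of_decomposition T A B _ hT.1.eigenvalues hT.eigenvalues_nonneg hU hU'
    hspec hα hγ hA hAc hB hBc a b

end Summit.QuantumFields.QCD.Cruxes.PhaseQuenchedFlavourDecay.CrossingSplitIntegrability

end
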